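import Summits.QuantumFields.BalabanUV.Beta.FP.GhostLoopCountingMix
import Summits.QuantumFields.BalabanUV.Beta.FP.MixLoopInstanceBlockFamilyGamma

/-!
# `Beta/FP/GhostLoopCountingMixGamma` — road «FP» (binder row D1), organisation γ, row **(GH-a) COUNTING, piece (g4)** «the four scalar constraint loops in MIX
# mass currency»: THE (MIX-1) ENGINE `MixLoopPowerCountingMassGamma.coarse_mix1_secondMoment_le` AT THE 0-FORM ROOTED BLOCK FAMILY AND THE SCALAR MINIMISER's COLUMNS,
# WITH THE FIELD-SIDE WINDOWED LETTER (M̃Γ) OF THE 0-FORM FAMILY DISCHARGED — sibling of `FP/GhostLoopCountingMix` ((MIX-2)), `…Quartic` ((MIX-4)), `…Cubic` ((MIX-3));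
# the loop's OTHER legs (`Γ = Gh` fine, `𝔊 = 𝔊_gh` coarse) stay ABSTRACT with the engine's letters DISPLAYED ([folklore] index plumbing on `ℤ⁴`; no road object identified)

HONEST FRAMING (cell `pub-balaban`, β sub-cell, verbatim): discharging `BetaPertH` makes Bałaban's UV stability UNCONDITIONAL — a real constructive-QFT
result; it is NOT the continuum limit and NOT the Clay problem.  THIS MODULE is [folklore] finite-sum plumbing composed BY NAME with ACCEPTED tree theorems:
`MixLoopPowerCountingMassGamma.coarse_mix1_secondMoment_le` (t4-ne7b-formalise-leaf-01-g23, RHOA-6c′ (MIX-1)), the gluon (INST-MIX1) pair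
`MixLoopInstanceBlockFamilyGamma.loopKernel₁_eq_filter` ∕ `MixLoopInstanceBlockFamilyField.sum_profile_half_le` (t4-ne7b-formalise-leaf-02-g23), the generic letters `AveragingJetLettersRooted.wfld`∕`ker₁`∕`sum_ker₁_le_mul_wfld`, this lineage's 0-form family
`ScalarAveragingJetLetters` (`sclW`∕`sclFld`∕`sclBg`, `sclW_nonneg`, `length_sclBg_le`) and `GhostLoopCountingMix` (`scl_ker₁_fld_local`, `windowedMass_scl_le`, `ghostColumn_engineLetters`).
It asserts nothing about Bałaban's objects, cites nothing, mints no `Prop` fact, has no `def`, 0 sorry.  The letters of `Γ` ((Γ) profile `C_Γ(‖c−c′‖∞+1)⁻²e^{−(δ∕N)‖c−c′‖∞}`) and of `𝔊`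
((G₀) sup `C_G`) are HYPOTHESES exactly as the engine displays them — their ghost instances (IR-4's `Gh` letters; `CoarseInverseScalar`) are the LEDGER's, NOT pinned here.  NOT the identification
of `T₁^{gh}` with the K_n-ghost's (MIX-1) term `tr(ΓQ̇′ᵀ𝔊Q̇′)` (KER-γ (α)), NOT the instance number (KER-γ (γ)), NOT (GH-a) as a whole, NOT `Mix_n = O(1)`, NOT hbook, NOT D1, NOT BetaPertH,
NOT continuum, NOT Clay.
HONEST DEPENDENCY: continuum YM on T⁴ ⇐ BetaPertH ∧ nine spine estimates (0/9 proved); BetaPertH ⇐ (D1) ∧ (D4) ∧ CAP+tail; G-an2-4 gates asym, D1 and NE2/3/4.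

ABSOLUTE RULE (cell charter, verbatim): «No internally-minted statement may enter as a cited fact. Every hypothesis is either kernel-proved in this package or a
verbatim quotation of a PUBLISHED theorem with page reference. The manuscript(s) under audit are NOT citable for their own disputed steps — they are the thing under
adjudication; programme-internal (2001/route/tribunal) claims are never citable.»

THE ROW (road-FP OWNER b2b-balaban-beta-d1-p3, `LEAVES-FP.md` row (GH-a) COUNTING (R-FP-28 (d)), piece (g4); the engine's header names the missing input: «(M̃Γ) — a `WindowedBlockMass`-type
lemma for `wfld`»; for the bond family this is t4-ne7b-formalise-leaf-02-g23's (INST-MIX1) `sum_wfld_blk_le` (owner GO 2026-08-21T04:00:44Z); THIS FILE is the 0-form twin, where the count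
is ONE LINE: at most ONE pair `(u, x′)`, `x′ ∈ fineBlock N`, has `N•u + x′ = c` — Euclidean division coordinatewise).  BINDING CHECK (R-FP-28 (d), displayed): NO lattice difference in
(MIX-1); smallness is mass × field-point count × the `Γ` profile.  CURRENCY: as in `GhostLoopCountingMix` (point labels; free radial rules with the length letter `ℓ₀` and the ℕ-valued radius
letter; free `p σ ≥ 0`, free `a > 0`); the offset window `W` is FREE (far offsets vanish), the coarse windows `U b` are FREE.

CONTENT.  §1 **`sum_wfld_scl_le`** (`Σ_{u∈Y} wfld (sclW N p) (sclFld N u) c ≤ N⁻⁴·Σ_σ p σ`, every finite `Y`), **`sum_sum_ker₁_scl_le`** (`Σ_{u∈Y}Σ_{b∈S} ker₁^{(u)} b c ≤ ℓ₀·N⁻⁴·Σp`, every field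
point `c`).  §2 **`fieldWindowedMass_scl_le`** ((M̃Γ) for the 0-form family, ANY `U`, ANY finite `W`, `S`, every fine centre `c`:
`≤ Ã := (ℓ₀·N⁻⁴·Σp)·(((1+80e^{δ∕4}(4∕δ)²) + (1+480e^{δ∕4}(4∕δ)⁴))·N²)` — i.e. `≍ ℓ₀·N⁻²·Σp`; the profile window sum is the gluon file's `sum_profile_half_le` BY NAME).
§3 **`coarse_mix1_secondMoment_scl`** (free offset window by the gluon file's `loopKernel₁_eq_filter` BY NAME; the engine at the 0-form jet with (M) := `windowedMass_scl_le`
(centre `N•v₀`), (M̃Γ) := §2, `R := R₀+1`; `G`, `Γ`, `J` ABSTRACT under (G₀)(Γ)(J)(J′)).  §4 THE END **`ghost_mix1_rem`** (columns `𝓘_gh = kerH (N−1) a` BY NAME via `ghostColumn_engineLetters`; `G`, `Γ` abstract):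
`Σ_{v∈V}‖v−v₀‖∞²·|Σ_{b,b′∈S} 𝓘_gh(b,v₀)·𝓘_gh(b′,v)·Σ_{u∈U b}Σ_{u′∈U b′} G u′ u·Σ_{w,w′∈W} ker₁^{(u)} b (b+w)·Γ (b+w) (b′+w′)·ker₁^{(u′)} b′ (b′+w′)|`
`≤ 3·C·C′·(1+16∕δ²)·(C_G·(C_Γ·(3+8(R₀+1)²))·Ã·A_M)`, `A_M = (ℓ₀·Σp)·e^{δR₀∕2}·(e^{δ∕2}(1+480e^{δ∕4}(4∕δ)⁴))`, `δ = deltaH 4 1` — EVERY power of `N` displayed: `N⁻²·(ℓ₀·Σp)²·C_G·C_Γ` × numbers (instance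
number + the `C_G`, `C_Γ` units = KER-γ (γ) ∕ LEDGER).  (v1 of this file's own `mix1Kernel_eq_filter` met `dedup.landed` against `loopKernel₁_eq_filter` at the dry-run — the landed one is
cited instead, as the gate asks.)
Provenance: D1 formalisation swarm, unit `b2b-balaban-beta-d1-formalise-leaf-05` gen 14 (prover-…-leaf-05-g14-0), 2026-08-21, first refusal on (GH-a) (g4) exercised (journal
INTENT 2026-08-21T03:56:26Z); «not in print; our bookkeeping»; no existing file touched.
-/

noncomputable section

namespace Summit.QuantumFields.BalabanUV.Beta.FP.GhostLoopCountingMixGamma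

open Finset Real
open scoped BigOperators
open Literature.MathematicalPhysics.QuantumFieldTheory.Balaban1983to89
open Literature.MathematicalPhysics.QuantumFieldTheory.Balaban1983to89.Beta
open DyadicShell (Pt supNorm)
open AxialBlockWeights (fineBlock mem_fineBlock)
open B5Hk103ScalarZd (kerH deltaH deltaH_pos)
open Summit.QuantumFields.BalabanUV.Beta.FP.AveragingJetLettersRooted (wfld ker₁ ker₁_nonneg sum_ker₁_le_mul_wfld)
open Summit.QuantumFields.BalabanUV.Beta.FP.ScalarAveragingJetLetters (sclW sclFld sclBg sclW_nonneg length_sclBg_le)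
open Summit.QuantumFields.BalabanUV.Beta.FP.MixLoopPowerCountingMassGamma (coarse_mix1_secondMoment_le)
open Summit.QuantumFields.BalabanUV.Beta.FP.GhostLoopCountingMix (scl_ker₁_fld_local windowedMass_scl_le ghostColumn_engineLetters)
open Summit.QuantumFields.BalabanUV.Beta.FP.MixLoopInstanceBlockFamilyField (sum_profile_half_le)
open Summit.QuantumFields.BalabanUV.Beta.FP.MixLoopInstanceBlockFamilyGamma (loopKernel₁_eq_filter)

section Scalar

variable {σ : Type*} [Fintype σ] {N : ℕ} {p : σ → ℝ} {rad : σ → Pt → Pt → List Pt} {ℓ₀ R₀ : ℕ}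

/-! ## §1 The all-blocks field-point count of the 0-form family -/

/-- [folklore] **THE ALL-BLOCKS FIELD-POINT COUNT**: `Σ_{u∈Y} wfld (sclW N p) (sclFld N u) c ≤ N⁻⁴·Σ_σ p σ` for EVERY finite coarse set `Y` (`N ≥ 1`, `p ≥ 0`) — at most ONE pair
`(u, x′)` with `x′ ∈ fineBlock N` has `N•u + x′ = c` (Euclidean division coordinatewise), so the field legs of ALL blocks together sit at a point at most once. -/
theorem sum_wfld_scl_le (hN : 1 ≤ N) (hp : ∀ s, 0 ≤ p s) (Y : Finset Pt) (c : Pt) :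
    ∑ u ∈ Y, wfld (sclW N p) (sclFld (σ := σ) N u) c ≤ ((N : ℝ) ^ 4)⁻¹ * ∑ s, p s := by
  classical
  have hP : 0 ≤ ∑ s, p s := Finset.sum_nonneg fun s _ => hp s
  -- each block's count is `#{x′ : N•u + x′ = c} · N⁻⁴·Σp`, and the pairs `(u,x′)` are unique
  have hwfld : ∀ u, wfld (sclW N p) (sclFld (σ := σ) N u) c
      = (((univ : Finset ↥(fineBlock N)).filter (fun x => N • u + x.1 = c)).card : ℝ) * (((N : ℝ) ^ 4)⁻¹ * ∑ s, p s) := by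
    intro u
    unfold wfld sclW sclFld
    rw [Finset.sum_filter, Fintype.sum_prod_type]
    have hinner : ∀ x : ↥(fineBlock N), (∑ s : σ, if N • u + x.1 = c then ((N : ℝ) ^ 4)⁻¹ * p s else 0)
        = if N • u + x.1 = c then ((N : ℝ) ^ 4)⁻¹ * ∑ s, p s else 0 := fun x => by
      split_ifs with h
      · rw [Finset.mul_sum]
      · simp
    simp_rw [hinner]
    rw [← Finset.sum_filter, Finset.sum_const, nsmul_eq_mul]
  simp_rw [hwfld]
  rw [← Finset.sum_mul]
  -- uniqueness across blocks: if `N•u + x = c = N•u′ + x′` with `x, x′ ∈ fineBlock N` then `u = u′` (and `x = x′`)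
  have huniq : ∀ u u' : Pt, ∀ x x' : Pt, x ∈ fineBlock N → x' ∈ fineBlock N → N • u + x = c → N • u' + x' = c → u = u' := by
    intro u u' x x' hx hx' h h'
    have hxi := mem_fineBlock.mp hx
    have hxi' := mem_fineBlock.mp hx'
    funext i
    have e1 : (N : ℤ) * u i + x i = c i := by
      have := congrFun h i; simpa [Pi.add_apply, Pi.smul_apply, nsmul_eq_mul] using this
    have e2 : (N : ℤ) * u' i + x' i = c i := by
      have := congrFun h' i; simpa [Pi.add_apply, Pi.smul_apply, nsmul_eq_mul] using this
    have h1 := hxi i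
    have h2 := hxi' i
    have hN' : (0 : ℤ) < N := by exact_mod_cast hN
    have q1 : c i / (N : ℤ) = u i := by
      rw [← e1, add_comm, Int.add_mul_ediv_left _ _ hN'.ne', Int.ediv_eq_zero_of_lt h1.1 h1.2, zero_add]
    have q2 : c i / (N : ℤ) = u' i := by
      rw [← e2, add_comm, Int.add_mul_ediv_left _ _ hN'.ne', Int.ediv_eq_zero_of_lt h2.1 h2.2, zero_add]
    rw [← q1, ← q2]
  -- hence the total count over `Y` is at most one
  have hcount : (∑ u ∈ Y, (((univ : Finset ↥(fineBlock N)).filter (fun x => N • u + x.1 = c)).card : ℝ)) ≤ 1 := by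
    have hnat : ∑ u ∈ Y, ((univ : Finset ↥(fineBlock N)).filter (fun x => N • u + x.1 = c)).card ≤ 1 := by
      by_contra hgt
      push Not at hgt
      -- two witnesses: either two blocks, or one block with two sites — both impossible
      have hpos : ∃ u ∈ Y, 0 < ((univ : Finset ↥(fineBlock N)).filter (fun x => N • u + x.1 = c)).card := by
        by_contra hnone
        push Not at hnone
        have : ∑ u ∈ Y, ((univ : Finset ↥(fineBlock N)).filter (fun x => N • u + x.1 = c)).card = 0 :=
          Finset.sum_eq_zero fun u hu => Nat.le_zero.mp (hnone u hu)
        omega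
      obtain ⟨u₀, hu₀, hc₀⟩ := hpos
      obtain ⟨x₀, hx₀⟩ := Finset.card_pos.mp hc₀
      have hx₀' := (Finset.mem_filter.mp hx₀).2
      -- every block's filter has card ≤ 1, and only `u₀`'s is nonempty
      have hle1 : ∀ u, ((univ : Finset ↥(fineBlock N)).filter (fun x => N • u + x.1 = c)).card ≤ 1 := by
        intro u
        refine Finset.card_le_one.mpr fun x₁ hx₁ x₂ hx₂ => Subtype.ext ?_
        have h1 := (Finset.mem_filter.mp hx₁).2
        have h2 := (Finset.mem_filter.mp hx₂).2
        exact add_left_cancel (h1.trans h2.symm)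
      have hzero : ∀ u ∈ Y, u ≠ u₀ → ((univ : Finset ↥(fineBlock N)).filter (fun x => N • u + x.1 = c)).card = 0 := by
        intro u _ hne
        by_contra hne0
        obtain ⟨x, hx⟩ := Finset.card_pos.mp (Nat.pos_of_ne_zero hne0)
        have hx' := (Finset.mem_filter.mp hx).2
        exact hne (huniq u u₀ x.1 x₀.1 x.2 x₀.2 hx' hx₀')
      have hsum : ∑ u ∈ Y, ((univ : Finset ↥(fineBlock N)).filter (fun x => N • u + x.1 = c)).card
          = ((univ : Finset ↥(fineBlock N)).filter (fun x => N • u₀ + x.1 = c)).card := by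
        rw [← Finset.sum_erase_add _ _ hu₀, Finset.sum_eq_zero (fun u hu => hzero u (Finset.mem_of_mem_erase hu) (Finset.ne_of_mem_erase hu)),
          zero_add]
      have := hle1 u₀
      omega
    exact_mod_cast hnat
  have _hN : (0 : ℝ) < N := by exact_mod_cast hN
  calc (∑ u ∈ Y, (((univ : Finset ↥(fineBlock N)).filter (fun x => N • u + x.1 = c)).card : ℝ)) * (((N : ℝ) ^ 4)⁻¹ * ∑ s, p s)
      ≤ 1 * (((N : ℝ) ^ 4)⁻¹ * ∑ s, p s) := mul_le_mul_of_nonneg_right hcount (by positivity)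
    _ = ((N : ℝ) ^ 4)⁻¹ * ∑ s, p s := one_mul _

/-- [folklore] **THE ALL-BLOCKS FIELD-SIDE MASS of the 0-form family**: `Σ_{u∈Y} Σ_{b∈S} ker₁^{(u)} b c ≤ ℓ₀·N⁻⁴·Σ_σ p σ` for every finite `Y`, `S` and every field point `c`
(`sum_ker₁_le_mul_wfld` per block, then `sum_wfld_scl_le`). -/
theorem sum_sum_ker₁_scl_le (hN : 1 ≤ N) (hp : ∀ s, 0 ≤ p s) (hrad : ∀ s u x', (rad s u x').length ≤ ℓ₀)
    (Y S : Finset Pt) (c : Pt) :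
    ∑ u ∈ Y, ∑ b ∈ S, ker₁ (sclW N p) (sclFld N u) (sclBg N u rad) b c ≤ ((ℓ₀ : ℕ) : ℝ) * (((N : ℝ) ^ 4)⁻¹ * ∑ s, p s) := by
  calc ∑ u ∈ Y, ∑ b ∈ S, ker₁ (sclW N p) (sclFld N u) (sclBg N u rad) b c
      ≤ ∑ u ∈ Y, ((ℓ₀ : ℕ) : ℝ) * wfld (sclW N p) (sclFld N u) c :=
        Finset.sum_le_sum fun u _ => sum_ker₁_le_mul_wfld (sclW_nonneg N hp) (length_sclBg_le u (hrad · u ·)) S c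
    _ = ((ℓ₀ : ℕ) : ℝ) * ∑ u ∈ Y, wfld (sclW N p) (sclFld N u) c := by rw [Finset.mul_sum]
    _ ≤ ((ℓ₀ : ℕ) : ℝ) * (((N : ℝ) ^ 4)⁻¹ * ∑ s, p s) := mul_le_mul_of_nonneg_left (sum_wfld_scl_le hN hp Y c) (Nat.cast_nonneg _)

/-! ## §2 The field-side windowed letter (M̃Γ) of the 0-form family -/

/-- **(M̃Γ) FOR THE 0-FORM FAMILY** ([folklore]; ANY coarse windows `U b′`, ANY finite `W`, `S`, every fine centre `c`): with `M₁(b′,w′) := Σ_{u′∈U b′}|ker₁^{(u′)} b′ (b′+w′)|`,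
`Σ_{b′∈S}Σ_{w′∈W} ((‖c−(b′+w′)‖∞+1)⁻² + N⁻²)·e^{−(δ∕(2N))‖c−(b′+w′)‖∞}·M₁(b′,w′) ≤ (ℓ₀·N⁻⁴·Σ_σ p σ)·(((1+80e^{δ∕4}(4∕δ)²) + (1+480e^{δ∕4}(4∕δ)⁴))·N²)`
— reindex the field leg `c′ = b′ + w′` into the finite window `T := S.biUnion (b′ ↦ W.image (b′ + ·))`, swap the sums, count the field point ONCE over all blocks (`sum_sum_ker₁_scl_le`),
then the profile window sum (`MixLoopInstanceBlockFamilyField.sum_profile_half_le` BY NAME); i.e. `Ã ≍ ℓ₀·N⁻²·Σp`, every power displayed. -/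
theorem fieldWindowedMass_scl_le {δ : ℝ} (hδ : 0 < δ) (hN : 1 ≤ N) (hp : ∀ s, 0 ≤ p s)
    (hrad : ∀ s u x', (rad s u x').length ≤ ℓ₀) (U : Pt → Finset Pt) (W S : Finset Pt) (c : Pt) :
    ∑ b' ∈ S, ∑ w' ∈ W, (1 / ((supNorm (c - (b' + w')) : ℝ) + 1) ^ 2 + ((N : ℝ) ^ 2)⁻¹) *
        Real.exp (-(δ / (2 * N)) * (supNorm (c - (b' + w')) : ℝ)) *
        (∑ u' ∈ U b', |ker₁ (sclW N p) (sclFld N u') (sclBg N u' rad) b' (b' + w')|)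
      ≤ (((ℓ₀ : ℕ) : ℝ) * (((N : ℝ) ^ 4)⁻¹ * ∑ s, p s)) *
        (((1 + 80 * Real.exp (δ / 4) * (4 / δ) ^ 2) + (1 + 480 * Real.exp (δ / 4) * (4 / δ) ^ 4)) * (N : ℝ) ^ 2) := by
  classical
  set Y : Finset Pt := S.biUnion U with hY
  set T : Finset Pt := S.biUnion (fun b' => W.image fun w' => b' + w') with hT
  have hω := sclW_nonneg N hp
  set φ : Pt → ℝ := fun z => (1 / ((supNorm z : ℝ) + 1) ^ 2 + ((N : ℝ) ^ 2)⁻¹) * Real.exp (-(δ / (2 * N)) * (supNorm z : ℝ)) with hφ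
  have hφ0 : ∀ z, 0 ≤ φ z := fun z => by rw [hφ]; positivity
  set F : Pt → Pt → ℝ := fun b' c' => φ (c - c') * ∑ u' ∈ Y, ker₁ (sclW N p) (sclFld N u') (sclBg N u' rad) b' c' with hF
  have hF0 : ∀ b' c', 0 ≤ F b' c' := fun b' c' => mul_nonneg (hφ0 _) (Finset.sum_nonneg fun u' _ => ker₁_nonneg hω _ _)
  -- step 1: `U b′ ⊆ Y`, `|ker₁| = ker₁`
  have hstep1 : ∀ b' ∈ S, ∀ w' ∈ W, (1 / ((supNorm (c - (b' + w')) : ℝ) + 1) ^ 2 + ((N : ℝ) ^ 2)⁻¹) *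
        Real.exp (-(δ / (2 * N)) * (supNorm (c - (b' + w')) : ℝ)) *
        (∑ u' ∈ U b', |ker₁ (sclW N p) (sclFld N u') (sclBg N u' rad) b' (b' + w')|) ≤ F b' (b' + w') := by
    intro b' hb' w' _
    have hUb : U b' ⊆ Y := by rw [hY]; exact Finset.subset_biUnion_of_mem U hb'
    rw [hF]
    refine mul_le_mul_of_nonneg_left ?_ (hφ0 _)
    have habs : ∀ u', |ker₁ (sclW N p) (sclFld N u') (sclBg N u' rad) b' (b' + w')| = ker₁ (sclW N p) (sclFld N u') (sclBg N u' rad) b' (b' + w') :=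
      fun u' => abs_of_nonneg (ker₁_nonneg hω _ _)
    simp only [habs]
    exact Finset.sum_le_sum_of_subset_of_nonneg hUb fun u' _ _ => ker₁_nonneg hω _ _
  -- step 2: reindex `w′ ↦ c′ = b′ + w′` and enlarge to `T`
  have hstep2 : ∀ b' ∈ S, ∑ w' ∈ W, F b' (b' + w') ≤ ∑ c' ∈ T, F b' c' := by
    intro b' hb'
    rw [← Finset.sum_image (s := W) (g := fun w' => b' + w') (f := fun c' => F b' c') (fun x _ y _ h => add_left_cancel h)]
    refine Finset.sum_le_sum_of_subset_of_nonneg ?_ fun c' _ _ => hF0 b' c'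
    rw [hT]
    exact Finset.subset_biUnion_of_mem (fun b' => W.image fun w' => b' + w') hb'
  -- step 3: swap and count the field point once over all blocks
  have hstep3 : ∑ b' ∈ S, ∑ c' ∈ T, F b' c' ≤ ∑ c' ∈ T, φ (c - c') * (((ℓ₀ : ℕ) : ℝ) * (((N : ℝ) ^ 4)⁻¹ * ∑ s, p s)) := by
    rw [Finset.sum_comm]
    refine Finset.sum_le_sum fun c' _ => ?_
    have e : ∑ b' ∈ S, F b' c' = φ (c - c') * ∑ u' ∈ Y, ∑ b' ∈ S, ker₁ (sclW N p) (sclFld N u') (sclBg N u' rad) b' c' := by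
      rw [hF, ← Finset.mul_sum, Finset.sum_comm]
    rw [e]
    exact mul_le_mul_of_nonneg_left (sum_sum_ker₁_scl_le hN hp hrad Y S c') (hφ0 _)
  -- step 4: the profile window sum, reindexed `c′ ↦ z = c − c′`
  have hstep4 : ∑ c' ∈ T, φ (c - c')
      ≤ ((1 + 80 * Real.exp (δ / 4) * (4 / δ) ^ 2) + (1 + 480 * Real.exp (δ / 4) * (4 / δ) ^ 4)) * (N : ℝ) ^ 2 := by
    rw [← Finset.sum_image (s := T) (g := fun c' => c - c') (f := fun z => φ z) (fun x _ y _ h => sub_right_injective h)]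
    exact sum_profile_half_le hδ hN _
  have hK0 : 0 ≤ ((ℓ₀ : ℕ) : ℝ) * (((N : ℝ) ^ 4)⁻¹ * ∑ s, p s) := by
    have : 0 ≤ ∑ s, p s := Finset.sum_nonneg fun s _ => hp s
    positivity
  calc ∑ b' ∈ S, ∑ w' ∈ W, (1 / ((supNorm (c - (b' + w')) : ℝ) + 1) ^ 2 + ((N : ℝ) ^ 2)⁻¹) *
          Real.exp (-(δ / (2 * N)) * (supNorm (c - (b' + w')) : ℝ)) *
          (∑ u' ∈ U b', |ker₁ (sclW N p) (sclFld N u') (sclBg N u' rad) b' (b' + w')|)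
      ≤ ∑ b' ∈ S, ∑ w' ∈ W, F b' (b' + w') := Finset.sum_le_sum fun b' hb' => Finset.sum_le_sum fun w' hw' => hstep1 b' hb' w' hw'
    _ ≤ ∑ b' ∈ S, ∑ c' ∈ T, F b' c' := Finset.sum_le_sum hstep2
    _ ≤ ∑ c' ∈ T, φ (c - c') * (((ℓ₀ : ℕ) : ℝ) * (((N : ℝ) ^ 4)⁻¹ * ∑ s, p s)) := hstep3
    _ = (((ℓ₀ : ℕ) : ℝ) * (((N : ℝ) ^ 4)⁻¹ * ∑ s, p s)) * ∑ c' ∈ T, φ (c - c') := by rw [← Finset.sum_mul, mul_comm]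
    _ ≤ _ := mul_le_mul_of_nonneg_left hstep4 hK0

/-! ## §3 Free offset window and the (MIX-1) engine at the 0-form family, abstract legs -/

/-- **THE (MIX-1) ENGINE AT THE 0-FORM FAMILY, ABSTRACT LEGS, FREE OFFSET WINDOW** ([folklore] plumbing; `coarse_mix1_secondMoment_le` BY NAME with
`qd u b c := ker₁ (sclW N p) (sclFld N u) (sclBg N u rad) b c` on the filtered window `‖w‖∞ ≤ (R₀+1)N` (far offsets vanish, `scl_ker₁_fld_local`), `R := R₀+1`, (M) := `windowedMass_scl_le` at the
centre `N•v₀`, (M̃Γ) := `fieldWindowedMass_scl_le`): under (G₀) `|G u u′| ≤ C_G`, (Γ) `|Γ c c′| ≤ C_Γ(‖c−c′‖∞+1)⁻²e^{−(δ∕N)‖c−c′‖∞}`, (J), (J′), for ANY `U`, all finite `W`, `S`, `V`, every `v₀`: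
`Σ_{v∈V}‖v−v₀‖∞²·|Σ_{b,b′∈S} J b v₀·J b′ v·k₁(b,b′)| ≤ 3·C_J·C_J′·(1+16∕δ²)·(C_G·(C_Γ·(3+8(R₀+1)²))·Ã·A_M)`. -/
theorem coarse_mix1_secondMoment_scl {δ : ℝ} (hδ : 0 < δ) (hN : 1 ≤ N) (hp : ∀ s, 0 ≤ p s)
    (hrad : ∀ s u x', (rad s u x').length ≤ ℓ₀)
    (hradR : ∀ (s : σ) (u : Pt) (x : ↥(fineBlock N)) (ℓ : Pt), ℓ ∈ rad s u x.1 → supNorm (ℓ - (N : ℤ) • u) ≤ R₀ * N)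
    (U : Pt → Finset Pt) (W : Finset Pt) {G Γ J : Pt → Pt → ℝ} {C_G C_Γ C_J C_J' : ℝ}
    (hG : ∀ u u', |G u u'| ≤ C_G)
    (hΓ : ∀ c c', |Γ c c'| ≤ C_Γ / ((supNorm (c - c') : ℝ) + 1) ^ 2 * Real.exp (-(δ / N) * (supNorm (c - c') : ℝ)))
    (S V : Finset Pt) (v₀ : Pt)
    (hJ : ∀ b, |J b v₀| ≤ C_J * Real.exp (-(δ / N) * (supNorm (b - (N : ℤ) • v₀) : ℝ)))
    (hJ' : ∀ b', ∑ v ∈ V, (1 + ((supNorm (b' - (N : ℤ) • v) : ℝ) / N) ^ 2) * |J b' v| ≤ C_J') :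
    ∑ v ∈ V, (supNorm (v - v₀) : ℝ) ^ 2 *
        |∑ b ∈ S, ∑ b' ∈ S, J b v₀ * J b' v *
          (∑ u ∈ U b, ∑ u' ∈ U b', G u' u *
            ∑ w ∈ W, ∑ w' ∈ W, ker₁ (sclW N p) (sclFld N u) (sclBg N u rad) b (b + w) * Γ (b + w) (b' + w') *
              ker₁ (sclW N p) (sclFld N u') (sclBg N u' rad) b' (b' + w'))|
      ≤ 3 * C_J * C_J' * (1 + 16 / δ ^ 2) *
        (C_G * (C_Γ * (3 + 8 * ((R₀ : ℝ) + 1) ^ 2)) *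
          ((((ℓ₀ : ℕ) : ℝ) * (((N : ℝ) ^ 4)⁻¹ * ∑ s, p s)) *
            (((1 + 80 * Real.exp (δ / 4) * (4 / δ) ^ 2) + (1 + 480 * Real.exp (δ / 4) * (4 / δ) ^ 4)) * (N : ℝ) ^ 2)) *
          ((((ℓ₀ : ℕ) : ℝ) * ∑ s, p s) * Real.exp (δ * R₀ / 2) *
            (Real.exp (δ / 2) * (1 + 480 * Real.exp (δ / 4) * (4 / δ) ^ 4)))) := by
  classical
  have hzW : ∀ u b w, ¬ supNorm w ≤ (R₀ + 1) * N →
      ker₁ (sclW N p) (sclFld N u) (sclBg N u rad) b (b + w) = 0 := by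
    intro u b w hfar
    by_contra hne
    have h := scl_ker₁_fld_local (p := p) hradR hne
    rw [add_sub_cancel_left] at h
    exact hfar h
  set W' : Finset Pt := W.filter (fun w => supNorm w ≤ (R₀ + 1) * N) with hW'
  have hWr : ∀ w ∈ W', supNorm w ≤ (R₀ + 1) * N := fun w hw => (Finset.mem_filter.mp hw).2
  have hker := fun b b' => loopKernel₁_eq_filter (q := fun u b c => ker₁ (sclW N p) (sclFld N u) (sclBg N u rad) b c) G Γ
    (fun w => supNorm w ≤ (R₀ + 1) * N) hzW U W b b'
  simp only [hker]
  have h := coarse_mix1_secondMoment_le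
    (qd := fun u b c => ker₁ (sclW N p) (sclFld N u) (sclBg N u rad) b c) (U := U) (W := W') (R := R₀ + 1)
    hδ hN hWr hG hΓ S V v₀ hJ hJ' (fun c => fieldWindowedMass_scl_le hδ hN hp hrad U W' S c)
    (windowedMass_scl_le hδ hN hp hrad hradR U W' S ((N : ℤ) • v₀))
  have e : (((R₀ + 1 : ℕ) : ℝ)) = (R₀ : ℝ) + 1 := by push_cast; ring
  rw [e] at h
  exact h

end Scalar

/-! ## §4 The END -/

/-- **THE END `ghost_mix1_rem` — ROW (GH-a) PIECE (g4), THE (MIX-1) GHOST TWIN** ([our object]; `d = 4`): with `C, C′` of `ghostColumn_engineLetters`, for EVERY `a > 0`, `N ≥ 1`, every 0-form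
rooted block family at blocking `N` (rules `σ`, `p σ ≥ 0`, radial words of length `≤ ℓ₀` within `R₀·N` of the anchor), every coarse leg `G` under (G₀) `|G u u′| ≤ C_G` and fine leg `Γ` under
(Γ) `|Γ c c′| ≤ C_Γ(‖c−c′‖∞+1)⁻²e^{−(δ∕N)‖c−c′‖∞}` (`δ := deltaH 4 1`), ANY coarse windows `U b`, all finite `W`, `S`, `V`, every `v₀` (`𝓘_gh(c,u) := kerH (N−1) a c u`):
`Σ_{v∈V}‖v−v₀‖∞²·|Σ_{b,b′∈S} 𝓘_gh(b,v₀)·𝓘_gh(b′,v)·Σ_{u∈U b}Σ_{u′∈U b′} G u′ u·Σ_{w,w′∈W} ker₁^{(u)} b (b+w)·Γ (b+w) (b′+w′)·ker₁^{(u′)} b′ (b′+w′)|`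
`≤ 3·C·C′·(1+16∕δ²)·(C_G·(C_Γ·(3+8(R₀+1)²))·Ã·A_M)`, `Ã = (ℓ₀·N⁻⁴·Σp)·(((1+80e^{δ∕4}(4∕δ)²) + (1+480e^{δ∕4}(4∕δ)⁴))·N²)`, `A_M = (ℓ₀·Σp)·e^{δR₀∕2}·(e^{δ∕2}(1+480e^{δ∕4}(4∕δ)⁴))` — EVERY
power of `N` displayed: `N⁻²·(ℓ₀·Σp)²·C_G·C_Γ` × numbers.  NOT the identification with the K_n-ghost's (MIX-1) term, NOT the `G`∕`Γ` instances, NOT `Mix_n = O(1)`, NOT (GH-a), NOT hbook, NOT D1,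
NOT BetaPertH. -/
theorem ghost_mix1_rem :
    ∃ C C' : ℝ, 0 ≤ C ∧ 0 ≤ C' ∧ ∀ {a : ℝ}, 0 < a → ∀ (N : ℕ), 1 ≤ N →
      ∀ {σ : Type*} [Fintype σ] {p : σ → ℝ} (_ : ∀ s, 0 ≤ p s)
        {rad : σ → Pt → Pt → List Pt} {ℓ₀ R₀ : ℕ} (_ : ∀ s u x', (rad s u x').length ≤ ℓ₀)
        (_ : ∀ (s : σ) (u : Pt) (x : ↥(fineBlock N)) (ℓ : Pt), ℓ ∈ rad s u x.1 → supNorm (ℓ - (N : ℤ) • u) ≤ R₀ * N)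
        {G Γ : Pt → Pt → ℝ} {C_G C_Γ : ℝ} (_ : ∀ u u', |G u u'| ≤ C_G)
        (_ : ∀ c c', |Γ c c'| ≤ C_Γ / ((supNorm (c - c') : ℝ) + 1) ^ 2 * Real.exp (-(deltaH 4 1 / N) * (supNorm (c - c') : ℝ)))
        (U : Pt → Finset Pt) (W S V : Finset Pt) (v₀ : Pt),
        ∑ v ∈ V, (supNorm (v - v₀) : ℝ) ^ 2 *
            |∑ b ∈ S, ∑ b' ∈ S, kerH (N - 1) a b v₀ * kerH (N - 1) a b' v *
              (∑ u ∈ U b, ∑ u' ∈ U b', G u' u *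
                ∑ w ∈ W, ∑ w' ∈ W, ker₁ (sclW N p) (sclFld N u) (sclBg N u rad) b (b + w) * Γ (b + w) (b' + w') *
                  ker₁ (sclW N p) (sclFld N u') (sclBg N u' rad) b' (b' + w'))|
          ≤ 3 * C * C' * (1 + 16 / deltaH 4 1 ^ 2) *
            (C_G * (C_Γ * (3 + 8 * ((R₀ : ℝ) + 1) ^ 2)) *
              ((((ℓ₀ : ℕ) : ℝ) * (((N : ℝ) ^ 4)⁻¹ * ∑ s, p s)) *
                (((1 + 80 * Real.exp (deltaH 4 1 / 4) * (4 / deltaH 4 1) ^ 2)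
                  + (1 + 480 * Real.exp (deltaH 4 1 / 4) * (4 / deltaH 4 1) ^ 4)) * (N : ℝ) ^ 2)) *
              ((((ℓ₀ : ℕ) : ℝ) * ∑ s, p s) * Real.exp (deltaH 4 1 * R₀ / 2) *
                (Real.exp (deltaH 4 1 / 2) * (1 + 480 * Real.exp (deltaH 4 1 / 4) * (4 / deltaH 4 1) ^ 4)))) := by
  obtain ⟨C, C', hC, hC', h⟩ := ghostColumn_engineLetters
  refine ⟨C, C', hC, hC', fun {a} ha N hN σ _ p hp rad ℓ₀ R₀ hrad hradR G Γ C_G C_Γ hG hΓ U W S V v₀ => ?_⟩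
  have hδ : 0 < deltaH 4 1 := deltaH_pos 4 one_pos
  obtain ⟨hI, hJ'⟩ := h ha N hN
  exact coarse_mix1_secondMoment_scl (N := N) hδ hN hp hrad hradR U W (J := fun b v => kerH (N - 1) a b v)
    hG hΓ S V v₀ (fun b => hI b v₀) (fun b' => hJ' b' V)

end Summit.QuantumFields.BalabanUV.Beta.FP.GhostLoopCountingMixGamma

end
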